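import Summits.CriticalPhenomena.PercolationContinuityZ3.Theorems.PercNearOneGluingNoHeavyLowerTailQ44SingleSourceCoreAR7A
import Summits.CriticalPhenomena.PercolationContinuityZ3.Theorems.PercNearOneGluingNoHeavyLowerTailQ44SingleSourceCoreAWS

/-!
# CORE A of the single-source packing from odd `ab`-co-goods (the form of R7-A that survives dense fibres)

Support file for crux `stmt-CriticalPhenomena-4575` (master-family programme, row `Q44`, single-source packing
`g ≥ b1 + h_a`), seat `prim-bnk-1` gen 30; memo `run/shared/lean/prim/prim-l12/FROM-prim-bnk-1-gen30-DENSE-FIBRES-WS.md` §1 (C4), §2.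

`…Q44SingleSourceCoreAR7A` recorded the reduction of CORE A to (R7-A) in the form "an odd co-good inside EVERY maximal
`ab`-member".  The same session's family-free sweep then produced fibres with an `a`-lobe (parallel edges and a `bc`-edge)
where that form FAILS for some family, so the hypothesis of `pack_singleSource_of_R7A_coreB` is not satisfiable for all
fibres.  The form with no exception in the dense tests is the `∃`-form (menu `AS` of the memo): every four-type family with
an `ab`-member has an odd-count co-good inside SOME `ab`-side of the fibre.  Only the co-good matters, so this file records
the reduction with the plain hypothesis "some co-good has odd containment count":

* `exists_odd_good_fourType_of_abCoGood` — four-type families (pure `K4s`-families by the symmetric `K4s`-scheme);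
* `pack_singleSource_of_abCoGood_coreB` — the full law from that hypothesis and CORE B, via
  `exists_odd_good_coreA_of_fourType`.

No sorries, no definitions, standard axioms.
-/

namespace Summit.CriticalPhenomena.PercolationContinuityZ3.Theorems

namespace TwoCopyMono

open Finset FourPointAtoms KernelPeeling Literature.Probability.Percolation

variable {n : ℕ}

/-- **Four-type families from odd co-goods.**  Graph fibre `(M, C)` with labelling `ι` in which every family of sides
of the four core types having an `ab`-member (`K1[ab|cy]`, `K2[ab|cy]` or `K4[ab]`) admits a co-good `K ⊆ M`
(`ι K = ⊥`, `ι (M \ K)` AC) contained in an odd number of members.  Then every nonempty four-type family has an odd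
target among the goods of `κ T = ι (T ∩ M)` (pure `K4s`-families by the symmetric `K4s`-scheme). [this work] -/
theorem exists_odd_good_fourType_of_abCoGood (a b c y : Fin n) (C M : Finset (Sym2 (Fin n)))
    (ι : Finset (Sym2 (Fin n)) → Fin 15) (hι : ∀ T : Finset (Sym2 (Fin n)), prof a b c y ↑(C ∪ T) = pp (ι T))
    (hCG : ∀ 𝒮' : Finset (Finset (Sym2 (Fin n))), (∀ S ∈ 𝒮', S ⊆ M) →
      (∀ S ∈ 𝒮', (ι S, ι (M \ S)) ∈ ({(11, 9), (11, 8), (6, 8), (8, 1)} : Finset (Fin 15 × Fin 15))) →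
      (∃ S ∈ 𝒮', (ι S, ι (M \ S)) ∈ ({(11, 9), (11, 8), (6, 8)} : Finset (Fin 15 × Fin 15))) →
      ∃ K : Finset (Sym2 (Fin n)), K ⊆ M ∧ ι K = 0 ∧ isAC (ι (M \ K)) ∧ Odd #(𝒮'.filter (fun S => K ⊆ S)))
    (𝒮 : Finset (Finset (Sym2 (Fin n)))) (hne : 𝒮.Nonempty) (h𝒮M : ∀ S ∈ 𝒮, S ⊆ M)
    (htypes : ∀ S ∈ 𝒮, (ι S, ι (M \ S)) ∈ ({(11, 9), (11, 8), (6, 8), (8, 1)} : Finset (Fin 15 × Fin 15))) :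
    ∃ T ∈ goods (fun T : Finset (Sym2 (Fin n)) => ι (T ∩ M)), Odd #(𝒮.filter (fun S => S ⊆ T)) := by
  classical
  set κ : Finset (Sym2 (Fin n)) → Fin 15 := fun T => ι (T ∩ M) with hκ
  have hmono : ∀ A B : Finset (Sym2 (Fin n)), A ⊆ B → ple (κ A) (κ B) = true := fun A B hAB =>
    ple_fibreMap a b c y C ι hι (Finset.inter_subset_inter hAB (subset_refl M))
  have hκS : ∀ S, S ⊆ M → κ S = ι S := fun S hS => by simp only [hκ, Finset.inter_eq_left.2 hS]
  have hκSc : ∀ S : Finset (Sym2 (Fin n)), κ Sᶜ = ι (M \ S) := fun S => by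
    simp only [hκ]; congr 1; ext e; simp [Finset.mem_sdiff, Finset.mem_inter, and_comm]
  have hmem4 : ∀ S ∈ 𝒮, (ι S, ι (M \ S)) ∈ ({(11, 9), (11, 8), (6, 8)} : Finset (Fin 15 × Fin 15)) ∨
      (ι S, ι (M \ S)) = (8, 1) := by
    intro S hS
    have h := htypes S hS
    simp only [Finset.mem_insert, Finset.mem_singleton] at h ⊢
    tauto
  by_cases hab : ∃ S ∈ 𝒮, (ι S, ι (M \ S)) ∈ ({(11, 9), (11, 8), (6, 8)} : Finset (Fin 15 × Fin 15))
  · obtain ⟨K, hKM, hK0, hKAC, hodd⟩ := hCG 𝒮 h𝒮M htypes hab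
    refine exists_odd_good_of_compl_mem (goods κ) (goods_upper κ hmono) 𝒮 K ?_ hodd
    unfold goods
    rw [Finset.mem_filter]
    refine ⟨Finset.mem_univ _, ?_, ?_⟩
    · rw [hκSc K]; exact hKAC
    · rw [compl_compl, hκS K hKM]; exact hK0
  · have hall : ∀ S ∈ 𝒮, ι S = 8 ∧ ι (M \ S) = 1 := by
      intro S hS
      rcases hmem4 S hS with h | h
      · exact absurd ⟨S, hS, h⟩ hab
      · exact (Prod.mk.injEq _ _ _ _ ▸ h : ι S = 8 ∧ ι (M \ S) = 1)
    obtain ⟨W₀, hW₀, hW₀max⟩ := Finset.exists_max_image 𝒮 Finset.card hne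
    have hmax : ∀ S ∈ 𝒮, W₀ ⊆ S → S = W₀ := fun S hS hsub =>
      (Finset.eq_of_subset_of_card_le hsub (hW₀max S hS)).symm
    refine exists_odd_good_symmetric_K4s a b c y C M ι hι 𝒮 h𝒮M
      (fun S hS => four_subset_six _ (htypes S hS)) W₀ hW₀ (hall W₀ hW₀).2 hmax (fun S hS => ?_)
    have h1 : ple (ι (W₀ \ S)) (ι (M \ S)) = true :=
      ple_fibreMap a b c y C ι hι (Finset.sdiff_subset_sdiff (h𝒮M W₀ hW₀) (subset_refl S))
    have h8 : ple (ι (W₀ \ S)) (ι W₀) = true := ple_fibreMap a b c y C ι hι Finset.sdiff_subset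
    rw [(hall S hS).2] at h1
    rw [(hall W₀ hW₀).1] at h8
    exact ple_one_ple_eight_eq_zero _ h1 h8

/-- **The full single-source packing from odd `ab`-co-goods and CORE B, all `n`.**  If, for the marked points `a b c y`
of `Fin n`, in every graph fibre with an `a`-lobe (i) every family of `K1[ab|cy]/K2[ab|cy]/K4[ab]/K4s[ay|bc]`-sides with
an `ab`-member has a co-good with odd containment count (verified form: inside some `ab`-side of the fibre), and (ii)
every CORE-B family has an odd target, then the single-source packing holds on every finite weighted graph on `Fin n`.
[this work] -/
theorem pack_singleSource_of_abCoGood_coreB (a b c y : Fin n)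
    (hCG : ∀ (M C : Finset (Sym2 (Fin n))) (ι : Finset (Sym2 (Fin n)) → Fin 15),
      (∀ T : Finset (Sym2 (Fin n)), prof a b c y ↑(C ∪ T) = pp (ι T)) →
      (∃ T ∈ M.powerset, (ι T, ι (M \ T)) ∈ ({(6, 7), (5, 7)} : Finset (Fin 15 × Fin 15))) →
      ∀ 𝒮' : Finset (Finset (Sym2 (Fin n))), (∀ S ∈ 𝒮', S ⊆ M) →
        (∀ S ∈ 𝒮', (ι S, ι (M \ S)) ∈ ({(11, 9), (11, 8), (6, 8), (8, 1)} : Finset (Fin 15 × Fin 15))) →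
        (∃ S ∈ 𝒮', (ι S, ι (M \ S)) ∈ ({(11, 9), (11, 8), (6, 8)} : Finset (Fin 15 × Fin 15))) →
        ∃ K : Finset (Sym2 (Fin n)), K ⊆ M ∧ ι K = 0 ∧ isAC (ι (M \ K)) ∧ Odd #(𝒮'.filter (fun S => K ⊆ S)))
    (hcoreB : ∀ (M C : Finset (Sym2 (Fin n))) (ι : Finset (Sym2 (Fin n)) → Fin 15),
      (∀ T : Finset (Sym2 (Fin n)), prof a b c y ↑(C ∪ T) = pp (ι T)) →
      (∃ T ∈ M.powerset, (ι T, ι (M \ T)) ∈ ({(6, 7), (5, 7)} : Finset (Fin 15 × Fin 15))) →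
      ∀ 𝒮 : Finset (Finset (Sym2 (Fin n))), 𝒮.Nonempty → (∀ S ∈ 𝒮, S ⊆ M) →
        (∀ S ∈ 𝒮, (ι S, ι (M \ S)) ∈ ({(6, 7), (5, 7), (11, 9), (11, 8), (6, 8), (6, 1), (8, 1)} : Finset (Fin 15 × Fin 15))) →
        ((∃ S ∈ 𝒮, (ι S, ι (M \ S)) = (5, 7)) ∧ (∃ S ∈ 𝒮, (ι S, ι (M \ S)) = (11, 9)) ∧
          (∃ S ∈ 𝒮, (ι S, ι (M \ S)) = (6, 1) ∨ (ι S, ι (M \ S)) = (6, 8))) →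
        ∃ T ∈ goods (fun T : Finset (Sym2 (Fin n)) => ι (T ∩ M)), Odd #(𝒮.filter (fun S => S ⊆ T)))
    (w : Sym2 (Fin n) → unitInterval) :
    cell w a b c y 6 * cell w a b c y 7 +
      cell w a b c y 5 * cell w a b c y 7 +
      cell w a b c y 11 * cell w a b c y 9 +
      cell w a b c y 11 * cell w a b c y 8 +
      cell w a b c y 6 * cell w a b c y 8 +
      cell w a b c y 6 * cell w a b c y 1 +
      cell w a b c y 8 * cell w a b c y 1 ≤
      (cell w a b c y 11 + cell w a b c y 14) * cell w a b c y 0 := by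
  refine pack_singleSource_of_cores a b c y (fun M C ι hι hlobe 𝒮 hne h𝒮M htypes hcore => ?_) w
  by_cases hB : (∃ S ∈ 𝒮, (ι S, ι (M \ S)) = (5, 7)) ∧ (∃ S ∈ 𝒮, (ι S, ι (M \ S)) = (11, 9)) ∧
      (∃ S ∈ 𝒮, (ι S, ι (M \ S)) = (6, 1) ∨ (ι S, ι (M \ S)) = (6, 8))
  · exact hcoreB M C ι hι hlobe 𝒮 hne h𝒮M htypes hB
  · rcases hcore with hA | hB'
    · exact exists_odd_good_coreA_of_fourType a b c y C M ι hι
        (fun 𝒮' hne' h𝒮M' htypes' =>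
          exists_odd_good_fourType_of_abCoGood a b c y C M ι hι (hCG M C ι hι hlobe) 𝒮' hne' h𝒮M' htypes')
        𝒮 h𝒮M htypes hA hB
    · exact absurd hB' hB

end TwoCopyMono

end Summit.CriticalPhenomena.PercolationContinuityZ3.Theorems
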